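import Summits.HubbardSuperconductivity.HubbardSuperconductivity.Theorems.MesoscopicPairOrder.Negative.PolarisedCeiling
import Summits.HubbardSuperconductivity.HubbardSuperconductivity.Theorems.MesoscopicPairOrder.Negative.SaturatedExclusion
import Summits.HubbardSuperconductivity.HubbardSuperconductivity.Theorems.MesoscopicPairOrder.Negative.NoSaturationWindow
import HarnessLib

/-!
# Crux `MesoscopicPairOrder` (item `stmt-HubbardSuperconductivity-7331`): NEARLY saturated ferromagnets are
# excluded too — the crux margin forces an extensive spin deficiency

Negative-side support (lead c8, line `pointwise_split`), corollaries of the polarised ceiling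
`boxSum_le_hundred_mul_spinDeficiency` (`PolarisedCeiling.lean`): `T_R(ψ) ≤ 100 R² (n - S) ‖ψ‖²` for every
vector of the `S^z = 0` sector `(n, n)` with total spin `S`. The standing exclusion of the crux
(`SaturatedExclusion.pointwise_false_of_saturated`: saturated sector ground states, `S = n`, infinitely often
along even sides kill the crux body at `(U, δ)`) is the case of spin deficiency `0`; here the deficiency may
be anything `o(L²)`:

* `exists_unit_groundState_boxSum_le` — normalisation: a sector ground state with `S² ψ = S(S+1) ψ` yields a
  NORMALISED sector ground state `φ` with `T_R(φ) ≤ 100 R² (n - S)`.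
* `pointwise_false_of_nearlySaturated` — **EXCLUSION**: if for every `κ > 0`, for infinitely many even `L`,
  the `(N_L, 0)` sector (`N_L = 2n`, `n = ⌊(1-δ)L²/2⌋`) of `hubbardTorus 2 L 1 U` has a ground state of total
  spin `S` with `n - S ≤ κ L²` (saturated OR nearly saturated ferromagnetism i.o.: polarisation density → full
  along a subsequence), then the crux body FAILS at `(U, δ)`. (The saturated case — `SaturatedExclusion.pointwise_false_of_saturated`
  — is the instance `S = n`, deficiency `0 ≤ κ L²`, of this hypothesis; it is not restated.)
* `superlinearBody_false_of_nearlySaturated`, `seedBody_false_of_nearlySaturated` — the same hypothesis kills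
  the load-bearing stub (B) of line `pointwise_split` at `(U, δ)` in its budget-free form (super-linear block
  pair order, `C = 1`) and in its registered budget form (`S = A = 0`).
* `spinDeficiency_ge_of_pointwise` — **NECESSITY**: if the crux body holds at `(U, δ)` with margin `m`, then for
  all large even `L` EVERY `S²`-diagonal `(N_L, 0)`-sector ground state has `m L² ≤ 100 (n - S)`: the spin
  deficiency is EXTENSIVE, i.e. the polarisation `S/n` of every sector ground-state multiplet stays below
  `1 - m L²/(100 n) ≈ 1 - m/(50(1-δ))`. (The ground eigenspace of the sector is spanned by `S²`-eigenvectors,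
  `[H, S²] = 0`.)

So the witness `(U, δ)` of any proof avoids not only the Nagaoka (saturated) corner but every point where
sector ground states are ferromagnetic with polarisation tending to `1` along a subsequence of even sides; for
the refuter this is the quantitative form of Disproof §4 (iii) with locality in place of the sum rule.
Nothing here proves or refutes the crux: partially polarised ferromagnetism at positive hole density is itself
open at every fixed `(U, δ)` of the range. Sources: H. Tasaki, Prog. Theor. Phys. 99 (1998) 489, pp. 20–21;
Y. Nagaoka, Phys. Rev. 147 (1966) 392; E. H. Lieb, PRL 62 (1989) 1201. No definition, no named fact, no sorry.
-/

noncomputable section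

-- the summit namespace repeats the problem name by design (D-0017)
set_option linter.dupNamespace false

namespace Summit.HubbardSuperconductivity.HubbardSuperconductivity.Theorems.MesoscopicPairOrder.Negative

open Matrix Finset Filter
open Literature.Probability.LatticeModels Literature.MathematicalPhysics.QuantumLattice
open scoped ComplexOrder ComplexConjugate

/-! ### Normalisation -/

/-- **A nearly saturated sector ground state, normalised.** A ground state `ψ` of the sector `(2n, S^z = 0)` of
`hubbardTorus 2 L 1 U` with `S² ψ = S(S+1) ψ`, `S ≤ n`, yields a NORMALISED ground state `φ` of the same sector
with `T_R(φ) ≤ 100 R² (n - S)` (`0 < R`, `2R ≤ L`): rescale (`exists_smul_unit`,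
`NoGo.isGroundStateInSector_smul`), read the sector as Lieb's `(n, n)` (`mem_szSector_two_mul_zero_iff`) and apply
`boxSum_le_hundred_mul_spinDeficiency`. [folklore] -/
theorem exists_unit_groundState_boxSum_le {U : ℝ} {L : ℕ} [NeZero L] (R : ℕ) (hR : 0 < R)
    (hRL : 2 * R ≤ L) {n S : ℕ} (hS : S ≤ n) {ψ : Fock (Orb (FermionTorus 2 L))}
    (hgs : IsGroundStateInSector (hubbardTorus 2 L 1 U) (2 * n) 0 ψ)
    (hspin : spinSq *ᵥ ψ = (((S : ℝ) * ((S : ℝ) + 1) : ℝ) : ℂ) • ψ) :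
    ∃ φ : Fock (Orb (FermionTorus 2 L)), star φ ⬝ᵥ φ = 1 ∧
      IsGroundStateInSector (hubbardTorus 2 L 1 U) (2 * n) 0 φ ∧
        (∑ x : TorusSite 2 L, ∑ y : TorusSite 2 L,
          (∏ i : Fin 2, max 0 (1 - |(((y i - x i).valMinAbs : ℤ) : ℝ)| / (R : ℝ))) *
            (star (localPair dWaveFormFactor L x *ᵥ φ) ⬝ᵥ (localPair dWaveFormFactor L y *ᵥ φ)).re) ≤
          100 * (R : ℝ) ^ 2 * ((n - S : ℕ) : ℝ) := by
  obtain ⟨c, hc, hc1⟩ := Literature.MathematicalPhysics.QuantumLattice.exists_smul_unit hgs.2.1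
  have hgs' := Summit.HubbardSuperconductivity.NoGo.isGroundStateInSector_smul _ _ _ hgs hc
  refine ⟨c • ψ, hc1, hgs', ?_⟩
  have hsec : IsInSector n n (c • ψ) := (mem_szSector_two_mul_zero_iff n (c • ψ)).1 hgs'.1
  have hSc : spinSq *ᵥ (c • ψ) = (((S : ℝ) * ((S : ℝ) + 1) : ℝ) : ℂ) • (c • ψ) := by
    rw [mulVec_smul, hspin, smul_comm]
  have h := boxSum_le_hundred_mul_spinDeficiency R hR hRL hS hsec hSc
  rwa [hc1, Complex.one_re, mul_one] at h

section Generic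

variable {Λ : Type*} [LinearOrder Λ] [Fintype Λ]

/-- Eigenvectors descend along `(S⁻)ᵈ` for any `H` commuting with `S⁻` (stated for a generic lattice `Λ`, so that
the matrix power elaborates exactly as in `NoSaturationWindow.isInSector_spinMinus_pow_mulVec`). [folklore] -/
theorem mulVec_spinMinus_pow_of_commute (H : Matrix (Finset (Orb Λ)) (Finset (Orb Λ)) ℂ)
    (hH : Commute H Literature.MathematicalPhysics.QuantumLattice.spinMinus) (d : ℕ) {w : Fock (Orb Λ)} {E : ℂ}
    (hE : H *ᵥ w = E • w) :
    H *ᵥ (Literature.MathematicalPhysics.QuantumLattice.spinMinus ^ d *ᵥ w) =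
      E • (Literature.MathematicalPhysics.QuantumLattice.spinMinus ^ d *ᵥ w) := by
  rw [mulVec_mulVec, (hH.pow_right d).eq, ← mulVec_mulVec, hE, mulVec_smul]

/-- `S²` passes through `(S⁻)ᵈ` (the Casimir commutes with the lowering operator,
`IsSu2Triple.su2Casimir_mul_M_pow`). [folklore] -/
theorem spinSq_mulVec_spinMinus_pow (d : ℕ) (w : Fock (Orb Λ)) :
    spinSq *ᵥ (Literature.MathematicalPhysics.QuantumLattice.spinMinus ^ d *ᵥ w) =
      Literature.MathematicalPhysics.QuantumLattice.spinMinus ^ d *ᵥ (spinSq *ᵥ w) := by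
  rw [mulVec_mulVec, ← LiebTwo.su2Casimir_spin_eq_spinSq,
    (LiebTwo.isSu2Triple_spin (Λ := Λ)).su2Casimir_mul_M_pow d, ← mulVec_mulVec]

end Generic

/-- **From the fully aligned member to the `S^z = 0` sector.** Let `φ ≠ 0` lie in Lieb's sector `(n + S, n - S)`
(`S ≤ n`), be FULLY ALIGNED (`S⁺ φ = 0`, so its total spin is exactly `S`) and carry the ground energy of the
`(2n, S^z = 0)` sector of `H = hubbardTorus 2 L 1 U`. Then `(S⁻)^S φ` is a ground state of that sector with
`S² = S(S+1)` — the shape consumed by `exists_unit_groundState_boxSum_le` (descent `isInSector_spinMinus_pow_mulVec`,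
`[H, S⁻] = 0`, `[S², S⁻] = 0`, Casimir `S² = (S^z)² + S^z + S⁻S⁺`). This is the refuter's natural interface: a
partially polarised ferromagnetic ground state is usually exhibited in its top sector. Lieb, PRL 62 (1989) 1201. [folklore] -/
theorem exists_szZero_groundState_of_aligned {U : ℝ} {L : ℕ} [NeZero L] {n S : ℕ} (hS : S ≤ n)
    {φ : Fock (Orb (FermionTorus 2 L))} (hφ : IsInSector (n + S) (n - S) φ) (hφ0 : φ ≠ 0)
    (hP : spinPlus *ᵥ φ = 0)
    (hH : hubbardTorus 2 L 1 U *ᵥ φ =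
      (((hubbardTorus 2 L 1 U).minEnergyOn (szSector (2 * n) 0) : ℝ) : ℂ) • φ) :
    ∃ ψ : Fock (Orb (FermionTorus 2 L)),
      IsGroundStateInSector (hubbardTorus 2 L 1 U) (2 * n) 0 ψ ∧
        spinSq *ᵥ ψ = (((S : ℝ) * ((S : ℝ) + 1) : ℝ) : ℂ) • ψ := by
  have htri := LiebTwo.isSu2Triple_spin (Λ := FermionTorus 2 L)
  -- the Casimir at the fully aligned vector: `S² φ = (S² + S) φ` in terms of `S^z φ = S φ`
  have hZ : HubbardWave0.spinZ *ᵥ φ = (S : ℂ) • φ := by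
    rw [LiebThm1.spinZ_mulVec_of_isInSector hφ]
    congr 1
    rw [Nat.cast_add, Nat.cast_sub hS]
    ring
  have hCas : spinSq *ᵥ φ = (((S : ℝ) * ((S : ℝ) + 1) : ℝ) : ℂ) • φ := by
    rw [← LiebTwo.su2Casimir_spin_eq_spinSq, htri.su2Casimir_eq, add_mulVec, add_mulVec, ← mulVec_mulVec,
      ← mulVec_mulVec, hP, mulVec_zero, add_zero, hZ, mulVec_smul, hZ, smul_smul, ← add_smul]
    congr 1
    push_cast
    ring
  -- descend along `(S⁻)^S` (`NoSaturationWindow.isInSector_spinMinus_pow_mulVec`)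
  obtain ⟨hsec, hne⟩ := isInSector_spinMinus_pow_mulVec hS hφ hφ0 S le_rfl
  rw [show n + S - S = n by omega, show n - S + S = n by omega] at hsec
  have hc : Commute (hubbardTorus 2 L 1 U) Literature.MathematicalPhysics.QuantumLattice.spinMinus :=
    LiebThm1.hamiltonian_commute_spinMinus (fermionTorusGraph 2 L) 1 U
  refine ⟨_, ⟨(mem_szSector_two_mul_zero_iff n _).2 hsec, hne, ?_⟩, ?_⟩
  · exact mulVec_spinMinus_pow_of_commute _ hc S hH
  · rw [spinSq_mulVec_spinMinus_pow, hCas, mulVec_smul]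

/-! ### Exclusion: nearly saturated ferromagnetic sector ground states infinitely often -/

/-- **EXCLUSION — the crux body fails at every `(U, δ)` with NEARLY SATURATED sector ground states along
infinitely many even sides.** Suppose that for every `κ > 0`, for infinitely many even `L`, the
`(2n, S^z = 0)` sector (`n = ⌊(1-δ)L²/2⌋`) of `hubbardTorus 2 L 1 U` has a ground state of total spin `S`
(`S² ψ = S(S+1) ψ`, `S ≤ n`) with spin deficiency `n - S ≤ κ L²`. Then no margin `m > 0` works at `(U, δ)`:
at the scale `R ≥ 1` the crux supplies for `R₀ = 1`, the normalised nearly saturated ground state has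
`T_R/L² ≤ 100 R² (n - S)/L² ≤ 100 κ R² < m R²` for `κ = m/200`. [folklore] -/
theorem pointwise_false_of_nearlySaturated {U δ : ℝ}
    (hns : ∀ κ : ℝ, 0 < κ → ∃ᶠ L : ℕ in atTop, Even L ∧
      ∃ (ψ : Fock (Orb (FermionTorus 2 L))) (S : ℕ), S ≤ ⌊(1 - δ) * (L : ℝ) ^ 2 / 2⌋₊ ∧
        IsGroundStateInSector (hubbardTorus 2 L 1 U) (2 * ⌊(1 - δ) * (L : ℝ) ^ 2 / 2⌋₊) 0 ψ ∧
          spinSq *ᵥ ψ = (((S : ℝ) * ((S : ℝ) + 1) : ℝ) : ℂ) • ψ ∧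
            ((⌊(1 - δ) * (L : ℝ) ^ 2 / 2⌋₊ - S : ℕ) : ℝ) ≤ κ * (L : ℝ) ^ 2) :
    ¬ (∃ m : ℝ, 0 < m ∧ ∀ R₀ : ℕ, ∃ R : ℕ, R₀ ≤ R ∧ ∃ L₀ : ℕ, ∀ (L : ℕ) [NeZero L], L₀ ≤ L → Even L →
        ∀ ψ : Fock (Orb (FermionTorus 2 L)), star ψ ⬝ᵥ ψ = 1 →
          IsGroundStateInSector (hubbardTorus 2 L 1 U) (2 * ⌊(1 - δ) * (L : ℝ) ^ 2 / 2⌋₊) 0 ψ →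
            m * (R : ℝ) ^ 2 ≤ (∑ x : TorusSite 2 L, ∑ y : TorusSite 2 L,
                  (∏ i : Fin 2, max 0 (1 - |(((y i - x i).valMinAbs : ℤ) : ℝ)| / (R : ℝ))) *
                    (star (localPair dWaveFormFactor L x *ᵥ ψ) ⬝ᵥ (localPair dWaveFormFactor L y *ᵥ ψ)).re) /
                (L : ℝ) ^ 2) := by
  rintro ⟨m, hm, hall⟩
  obtain ⟨R, hR, L₀, hL⟩ := hall 1
  obtain ⟨L, ⟨hEven, ψ, S, hS, hgs, hspin, hdef⟩, hLge⟩ :=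
    ((hns (m / 200) (by positivity)).and_eventually (eventually_ge_atTop (max L₀ (2 * R)))).exists
  have hL0 : L₀ ≤ L := le_of_max_le_left hLge
  have h2R : 2 * R ≤ L := le_of_max_le_right hLge
  haveI : NeZero L := ⟨by omega⟩
  have hRpos : 0 < R := hR
  obtain ⟨φ, hφ1, hφgs, hT⟩ := exists_unit_groundState_boxSum_le (U := U) R hRpos h2R hS hgs hspin
  have hbad := hL L hL0 hEven φ hφ1 hφgs
  have hLpos : (0 : ℝ) < L := Nat.cast_pos.2 (Nat.pos_of_ne_zero (NeZero.ne L))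
  have hL2 : (0 : ℝ) < (L : ℝ) ^ 2 := by positivity
  rw [le_div_iff₀ hL2] at hbad
  have hR1 : (1 : ℝ) ≤ R := by exact_mod_cast hR
  have hR2 : (0 : ℝ) < (R : ℝ) ^ 2 := by positivity
  -- `m R² L² ≤ T_R(φ) ≤ 100 R² (n - S) ≤ 100 R² (m/200) L² = (m/2) R² L²`
  have h1 : m * (R : ℝ) ^ 2 * (L : ℝ) ^ 2 ≤ 100 * (R : ℝ) ^ 2 * (m / 200 * (L : ℝ) ^ 2) :=
    hbad.trans (hT.trans (mul_le_mul_of_nonneg_left hdef (by positivity)))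
  nlinarith [mul_pos (mul_pos hm hR2) hL2]

/-- **EXCLUSION, top-sector form.** The same conclusion when the nearly saturated ground states are exhibited as
FULLY ALIGNED vectors: for every `κ > 0`, for infinitely many even `L`, some `φ ≠ 0` of Lieb's sector `(n + S, n - S)`
with `S⁺ φ = 0`, the ground energy of the `(2n, 0)` sector, and `n - S ≤ κ L²`
(`exists_szZero_groundState_of_aligned` + `pointwise_false_of_nearlySaturated`). [folklore] -/
theorem pointwise_false_of_alignedNearlySaturated {U δ : ℝ}
    (hns : ∀ κ : ℝ, 0 < κ → ∃ᶠ L : ℕ in atTop, Even L ∧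
      ∃ (φ : Fock (Orb (FermionTorus 2 L))) (S : ℕ), S ≤ ⌊(1 - δ) * (L : ℝ) ^ 2 / 2⌋₊ ∧
        IsInSector (⌊(1 - δ) * (L : ℝ) ^ 2 / 2⌋₊ + S) (⌊(1 - δ) * (L : ℝ) ^ 2 / 2⌋₊ - S) φ ∧ φ ≠ 0 ∧
          spinPlus *ᵥ φ = 0 ∧
            hubbardTorus 2 L 1 U *ᵥ φ =
              (((hubbardTorus 2 L 1 U).minEnergyOn (szSector (2 * ⌊(1 - δ) * (L : ℝ) ^ 2 / 2⌋₊) 0) : ℝ) : ℂ) • φ ∧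
            ((⌊(1 - δ) * (L : ℝ) ^ 2 / 2⌋₊ - S : ℕ) : ℝ) ≤ κ * (L : ℝ) ^ 2) :
    ¬ (∃ m : ℝ, 0 < m ∧ ∀ R₀ : ℕ, ∃ R : ℕ, R₀ ≤ R ∧ ∃ L₀ : ℕ, ∀ (L : ℕ) [NeZero L], L₀ ≤ L → Even L →
        ∀ ψ : Fock (Orb (FermionTorus 2 L)), star ψ ⬝ᵥ ψ = 1 →
          IsGroundStateInSector (hubbardTorus 2 L 1 U) (2 * ⌊(1 - δ) * (L : ℝ) ^ 2 / 2⌋₊) 0 ψ →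
            m * (R : ℝ) ^ 2 ≤ (∑ x : TorusSite 2 L, ∑ y : TorusSite 2 L,
                  (∏ i : Fin 2, max 0 (1 - |(((y i - x i).valMinAbs : ℤ) : ℝ)| / (R : ℝ))) *
                    (star (localPair dWaveFormFactor L x *ᵥ ψ) ⬝ᵥ (localPair dWaveFormFactor L y *ᵥ ψ)).re) /
                (L : ℝ) ^ 2) := by
  refine pointwise_false_of_nearlySaturated fun κ hκ => ?_
  refine ((hns κ hκ).and_eventually (eventually_ge_atTop 1)).mono fun L hL => ?_
  obtain ⟨⟨hE, φ, S, hS, hφ, hφ0, hP, hH, hdef⟩, hL1⟩ := hL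
  haveI : NeZero L := ⟨by omega⟩
  obtain ⟨ψ, hgs, hspin⟩ := exists_szZero_groundState_of_aligned (U := U) hS hφ hφ0 hP hH
  exact ⟨hE, ψ, S, hS, hgs, hspin, hdef⟩

/-! ### The same exclusion for stub (B) of line `pointwise_split` at its single scale -/

/-- **Nearly saturated ferromagnets kill the budget-free form of stub (B) at `(U, δ)`** (super-linear block
pair order `∀ C ∃ R₀ > 0 … : C R₀ ≤ T_{R₀}(ψ)/L²`, cf. `SeedSaturatedExclusion.superlinearBody_false_of_saturated`):
test `C = 1`, then `κ = 1/(200 R₀)` gives `T_{R₀}/L² ≤ 100 R₀² κ = R₀/2 < R₀`. [folklore] -/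
theorem superlinearBody_false_of_nearlySaturated {U δ : ℝ}
    (hns : ∀ κ : ℝ, 0 < κ → ∃ᶠ L : ℕ in atTop, Even L ∧
      ∃ (ψ : Fock (Orb (FermionTorus 2 L))) (S : ℕ), S ≤ ⌊(1 - δ) * (L : ℝ) ^ 2 / 2⌋₊ ∧
        IsGroundStateInSector (hubbardTorus 2 L 1 U) (2 * ⌊(1 - δ) * (L : ℝ) ^ 2 / 2⌋₊) 0 ψ ∧
          spinSq *ᵥ ψ = (((S : ℝ) * ((S : ℝ) + 1) : ℝ) : ℂ) • ψ ∧
            ((⌊(1 - δ) * (L : ℝ) ^ 2 / 2⌋₊ - S : ℕ) : ℝ) ≤ κ * (L : ℝ) ^ 2) :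
    ¬ (∀ C : ℝ, ∃ R₀ : ℕ, 0 < R₀ ∧ ∃ L₀ : ℕ, ∀ (L : ℕ) [NeZero L], L₀ ≤ L → Even L →
      ∀ ψ : Fock (Orb (FermionTorus 2 L)), star ψ ⬝ᵥ ψ = 1 →
        IsGroundStateInSector (hubbardTorus 2 L 1 U) (2 * ⌊(1 - δ) * (L : ℝ) ^ 2 / 2⌋₊) 0 ψ →
          C * (R₀ : ℝ) ≤ (∑ x : TorusSite 2 L, ∑ y : TorusSite 2 L,
            (∏ i : Fin 2, max 0 (1 - |(((y i - x i).valMinAbs : ℤ) : ℝ)| / (R₀ : ℝ))) *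
              (star (localPair dWaveFormFactor L x *ᵥ ψ) ⬝ᵥ (localPair dWaveFormFactor L y *ᵥ ψ)).re) /
                (L : ℝ) ^ 2) := by
  intro hB
  obtain ⟨R₀, hR₀, L₀, hL⟩ := hB 1
  have hRpos : (0 : ℝ) < R₀ := Nat.cast_pos.2 hR₀
  obtain ⟨L, ⟨hEven, ψ, S, hS, hgs, hspin, hdef⟩, hLge⟩ :=
    ((hns (1 / (200 * (R₀ : ℝ))) (by positivity)).and_eventually
      (eventually_ge_atTop (max L₀ (2 * R₀)))).exists
  have hL0 : L₀ ≤ L := le_of_max_le_left hLge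
  have h2R : 2 * R₀ ≤ L := le_of_max_le_right hLge
  haveI : NeZero L := ⟨by omega⟩
  obtain ⟨φ, hφ1, hφgs, hT⟩ := exists_unit_groundState_boxSum_le (U := U) R₀ hR₀ h2R hS hgs hspin
  have hbad := hL L hL0 hEven φ hφ1 hφgs
  have hLpos : (0 : ℝ) < L := Nat.cast_pos.2 (Nat.pos_of_ne_zero (NeZero.ne L))
  have hL2 : (0 : ℝ) < (L : ℝ) ^ 2 := by positivity
  rw [one_mul, le_div_iff₀ hL2] at hbad
  have h1 : (R₀ : ℝ) * (L : ℝ) ^ 2 ≤ 100 * (R₀ : ℝ) ^ 2 * (1 / (200 * (R₀ : ℝ)) * (L : ℝ) ^ 2) :=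
    hbad.trans (hT.trans (mul_le_mul_of_nonneg_left hdef (by positivity)))
  have e : 100 * (R₀ : ℝ) ^ 2 * (1 / (200 * (R₀ : ℝ)) * (L : ℝ) ^ 2) = (R₀ : ℝ) * (L : ℝ) ^ 2 / 2 := by
    field_simp
    ring
  rw [e] at h1
  nlinarith [mul_pos hRpos hL2]

/-- **Nearly saturated ferromagnets kill the registered (budget) form of stub (B) at `(U, δ)`**
(cf. `SeedSaturatedExclusion.seedBody_false_of_saturated`): zero budget `S = A = 0` yields a scale `R₀ > 0` and a
margin `m₀ > 0`; `κ = m₀/200` gives `T_{R₀}/L² ≤ m₀ R₀²/2 < m₀ R₀²`. [folklore] -/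
theorem seedBody_false_of_nearlySaturated {U δ : ℝ}
    (hns : ∀ κ : ℝ, 0 < κ → ∃ᶠ L : ℕ in atTop, Even L ∧
      ∃ (ψ : Fock (Orb (FermionTorus 2 L))) (S : ℕ), S ≤ ⌊(1 - δ) * (L : ℝ) ^ 2 / 2⌋₊ ∧
        IsGroundStateInSector (hubbardTorus 2 L 1 U) (2 * ⌊(1 - δ) * (L : ℝ) ^ 2 / 2⌋₊) 0 ψ ∧
          spinSq *ᵥ ψ = (((S : ℝ) * ((S : ℝ) + 1) : ℝ) : ℂ) • ψ ∧
            ((⌊(1 - δ) * (L : ℝ) ^ 2 / 2⌋₊ - S : ℕ) : ℝ) ≤ κ * (L : ℝ) ^ 2) :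
    ¬ (∀ S A : ℝ, 0 ≤ S → 0 ≤ A →
      ∃ (R₀ : ℕ) (ε m₀ : ℝ), 0 < R₀ ∧ 0 < ε ∧
        32 * ε * (S * ε + A) + (S + A / ε) / (R₀ : ℝ) ^ 2 < m₀ ∧
        ∃ L₀ : ℕ, ∀ (L : ℕ) [NeZero L], L₀ ≤ L → Even L →
          ∀ ψ : Fock (Orb (FermionTorus 2 L)), star ψ ⬝ᵥ ψ = 1 →
            IsGroundStateInSector (hubbardTorus 2 L 1 U) (2 * ⌊(1 - δ) * (L : ℝ) ^ 2 / 2⌋₊) 0 ψ →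
              m₀ * (R₀ : ℝ) ^ 2 ≤ (∑ x : Fin 2 → ZMod L, ∑ y : Fin 2 → ZMod L,
                (∏ i : Fin 2, max 0 (1 - |(((y i - x i).valMinAbs : ℤ) : ℝ)| / (R₀ : ℝ))) *
                  (star (Matrix.mulVec (localPair dWaveFormFactor L x) ψ) ⬝ᵥ
                    Matrix.mulVec (localPair dWaveFormFactor L y) ψ).re) / (L : ℝ) ^ 2) := by
  intro hB
  obtain ⟨R₀, ε, m₀, hR₀, hε, hleak, L₀, hL⟩ := hB 0 0 le_rfl le_rfl
  have hm₀ : 0 < m₀ := by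
    have : 32 * ε * (0 * ε + 0) + (0 + 0 / ε) / (R₀ : ℝ) ^ 2 = 0 := by ring
    linarith
  have hRpos : (0 : ℝ) < R₀ := Nat.cast_pos.2 hR₀
  obtain ⟨L, ⟨hEven, ψ, S, hS, hgs, hspin, hdef⟩, hLge⟩ :=
    ((hns (m₀ / 200) (by positivity)).and_eventually (eventually_ge_atTop (max L₀ (2 * R₀)))).exists
  have hL0 : L₀ ≤ L := le_of_max_le_left hLge
  have h2R : 2 * R₀ ≤ L := le_of_max_le_right hLge
  haveI : NeZero L := ⟨by omega⟩
  obtain ⟨φ, hφ1, hφgs, hT⟩ := exists_unit_groundState_boxSum_le (U := U) R₀ hR₀ h2R hS hgs hspin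
  have hbad := hL L hL0 hEven φ hφ1 hφgs
  have hLpos : (0 : ℝ) < L := Nat.cast_pos.2 (Nat.pos_of_ne_zero (NeZero.ne L))
  have hL2 : (0 : ℝ) < (L : ℝ) ^ 2 := by positivity
  rw [le_div_iff₀ hL2] at hbad
  have hR2 : (0 : ℝ) < (R₀ : ℝ) ^ 2 := by positivity
  have h1 : m₀ * (R₀ : ℝ) ^ 2 * (L : ℝ) ^ 2 ≤ 100 * (R₀ : ℝ) ^ 2 * (m₀ / 200 * (L : ℝ) ^ 2) :=
    hbad.trans (hT.trans (mul_le_mul_of_nonneg_left hdef (by positivity)))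
  nlinarith [mul_pos (mul_pos hm₀ hR2) hL2]

/-! ### Necessity: the crux margin forces an extensive spin deficiency -/

/-- **NECESSITY — at the witness of any proof the spin deficiency of sector ground states is EXTENSIVE.** If
the crux body holds at `(U, δ)` with margin `m`, then for all large even `L`, every ground state `ψ` of the
`(2n, S^z = 0)` sector (`n = ⌊(1-δ)L²/2⌋`) of `hubbardTorus 2 L 1 U` that is an `S²`-eigenvector, `S² ψ = S(S+1) ψ`
with `S ≤ n`, has `m L² ≤ 100 (n - S)`: its multiplet has polarisation `S/n ≤ 1 - m L²/(100 n)`. (At the scale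
`R ≥ 1` supplied for `R₀ = 1`: `m R² ≤ T_R(φ)/L² ≤ 100 R² (n - S)/L²` for the normalised `φ`.) Since `[H, S²] = 0`
the ground eigenspace of the sector is spanned by such `ψ`. [folklore] -/
theorem spinDeficiency_ge_of_pointwise {U δ : ℝ}
    (h : ∃ m : ℝ, 0 < m ∧ ∀ R₀ : ℕ, ∃ R : ℕ, R₀ ≤ R ∧ ∃ L₀ : ℕ, ∀ (L : ℕ) [NeZero L], L₀ ≤ L → Even L →
        ∀ ψ : Fock (Orb (FermionTorus 2 L)), star ψ ⬝ᵥ ψ = 1 →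
          IsGroundStateInSector (hubbardTorus 2 L 1 U) (2 * ⌊(1 - δ) * (L : ℝ) ^ 2 / 2⌋₊) 0 ψ →
            m * (R : ℝ) ^ 2 ≤ (∑ x : TorusSite 2 L, ∑ y : TorusSite 2 L,
                  (∏ i : Fin 2, max 0 (1 - |(((y i - x i).valMinAbs : ℤ) : ℝ)| / (R : ℝ))) *
                    (star (localPair dWaveFormFactor L x *ᵥ ψ) ⬝ᵥ (localPair dWaveFormFactor L y *ᵥ ψ)).re) /
                (L : ℝ) ^ 2) :
    ∃ m : ℝ, 0 < m ∧ ∃ L₀ : ℕ, ∀ (L : ℕ) [NeZero L], L₀ ≤ L → Even L →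
      ∀ ψ : Fock (Orb (FermionTorus 2 L)),
        IsGroundStateInSector (hubbardTorus 2 L 1 U) (2 * ⌊(1 - δ) * (L : ℝ) ^ 2 / 2⌋₊) 0 ψ →
          ∀ S : ℕ, S ≤ ⌊(1 - δ) * (L : ℝ) ^ 2 / 2⌋₊ →
            spinSq *ᵥ ψ = (((S : ℝ) * ((S : ℝ) + 1) : ℝ) : ℂ) • ψ →
              m * (L : ℝ) ^ 2 ≤ 100 * ((⌊(1 - δ) * (L : ℝ) ^ 2 / 2⌋₊ - S : ℕ) : ℝ) := by
  obtain ⟨m, hm, hall⟩ := h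
  obtain ⟨R, hR, L₀, hL⟩ := hall 1
  refine ⟨m, hm, max L₀ (2 * R), fun L _ hLge hEven ψ hgs S hS hspin => ?_⟩
  have hL0 : L₀ ≤ L := le_of_max_le_left hLge
  have h2R : 2 * R ≤ L := le_of_max_le_right hLge
  obtain ⟨φ, hφ1, hφgs, hT⟩ := exists_unit_groundState_boxSum_le (U := U) R hR h2R hS hgs hspin
  have hgood := hL L hL0 hEven φ hφ1 hφgs
  have hLpos : (0 : ℝ) < L := Nat.cast_pos.2 (Nat.pos_of_ne_zero (NeZero.ne L))
  have hL2 : (0 : ℝ) < (L : ℝ) ^ 2 := by positivity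
  rw [le_div_iff₀ hL2] at hgood
  have hR1 : (1 : ℝ) ≤ R := by exact_mod_cast hR
  have hR2 : (1 : ℝ) ≤ (R : ℝ) ^ 2 := by nlinarith
  -- `m R² L² ≤ 100 R² (n - S)`, divide by `R² ≥ 1`
  have h1 : m * (R : ℝ) ^ 2 * (L : ℝ) ^ 2 ≤ 100 * (R : ℝ) ^ 2 * ((⌊(1 - δ) * (L : ℝ) ^ 2 / 2⌋₊ - S : ℕ) : ℝ) :=
    hgood.trans hT
  have hkey : (R : ℝ) ^ 2 * (m * (L : ℝ) ^ 2) ≤ (R : ℝ) ^ 2 * (100 * ((⌊(1 - δ) * (L : ℝ) ^ 2 / 2⌋₊ - S : ℕ) : ℝ)) := by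
    calc (R : ℝ) ^ 2 * (m * (L : ℝ) ^ 2) = m * (R : ℝ) ^ 2 * (L : ℝ) ^ 2 := by ring
      _ ≤ _ := h1
      _ = _ := by ring
  exact le_of_mul_le_mul_left hkey (by positivity)

/-- **Registered form** (`pointwiseFalseOfNearlySaturated`, sub-goal of stmt-7331): nearly saturated sector
ground states infinitely often (spin deficiency `≤ κ L²` for every `κ > 0`) refute the crux body at `(U, δ)`,
one-line verbatim signature. [folklore] -/
theorem pointwiseFalseOfNearlySaturated : ∀ {U δ : ℝ}, (∀ κ : ℝ, 0 < κ → ∃ᶠ L : ℕ in atTop, Even L ∧ ∃ (ψ : Fock (Orb (FermionTorus 2 L))) (S : ℕ), S ≤ ⌊(1 - δ) * (L : ℝ) ^ 2 / 2⌋₊ ∧ IsGroundStateInSector (hubbardTorus 2 L 1 U) (2 * ⌊(1 - δ) * (L : ℝ) ^ 2 / 2⌋₊) 0 ψ ∧ spinSq *ᵥ ψ = (((S : ℝ) * ((S : ℝ) + 1) : ℝ) : ℂ) • ψ ∧ ((⌊(1 - δ) * (L : ℝ) ^ 2 / 2⌋₊ - S : ℕ) : ℝ) ≤ κ * (L : ℝ)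 ^ 2) → ¬ (∃ m : ℝ, 0 < m ∧ ∀ R₀ : ℕ, ∃ R : ℕ, R₀ ≤ R ∧ ∃ L₀ : ℕ, ∀ (L : ℕ) [NeZero L], L₀ ≤ L → Even L → ∀ ψ : Fock (Orb (FermionTorus 2 L)), star ψ ⬝ᵥ ψ = 1 → IsGroundStateInSector (hubbardTorus 2 L 1 U) (2 * ⌊(1 - δ) * (L : ℝ) ^ 2 / 2⌋₊) 0 ψ → m * (R : ℝ) ^ 2 ≤ (∑ x : TorusSite 2 L, ∑ y : TorusSite 2 L, (∏ i : Fin 2, max 0 (1 - |(((y i - x i).valMinAbs : ℤ) : ℝ)| / (R : ℝ))) * (star (localPair dWaveFormFactor L x *ᵥ ψ) ⬝ᵥ (localPair dWaveFormFactor L y *ᵥ ψ)).re) / (L : ℝ) ^ 2) :=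
  fun hns => pointwise_false_of_nearlySaturated hns

end Summit.HubbardSuperconductivity.HubbardSuperconductivity.Theorems.MesoscopicPairOrder.Negative
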